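import Summits.AnomalousDissipation.AnomalousDissipation.Theorems.WindLineWindLineFeedsTarget

/-!
# Strategist census companion (typed) — crux `WindLine.WindyGalerkinSteadyZerothLaw`
# (stmt-AnomalousDissipation-11414), crux-strategist s1 / gen 1, 2026-08-17

Companion to `Cruxes/WindyGalerkinSteadyZerothLaw/STRATEGY-CENSUS.md`.  Everything here is about what the
FREE MOMENTUM (the wind) changes relative to the calm sibling crux 2986 (`MirrorVariety.GalerkinSteadyZerothLaw`,
census v2 + D8 in `Cruxes/GalerkinSteadyZerothLaw/`).  Contents:

* §1 `WindLoudnessTradeoff` (Negation N-W1; typed, provable now, but WEAK — see its docstring): testing the windy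
  steady equations against the smooth first-shell field `A = (c·∇)⁻¹ f` (`c = ∫u` the wind) gives
  `(f, u) = −∫⟪u−c, ((u−c)·∇)A⟫ − ν(u−c, ΔA)`, hence `ν‖∇u‖² ≤ ‖DA‖_∞ ∫|u−c|² + ν‖ΔA‖₂ ‖u−c‖₂` with
  `sup‖DA‖_op = 1/|s|` for the cyclic force and `e = (1,√2,√3)` (one entry per row and column): loudness `≤ W/|s| + O(ν)`.
  Checked against the energy budget (`6s² + W ≤ E`, `ε ≤ 1.22√W`) it adds almost nothing — recorded as a dead end.
* §2 the ODD-CROSSING objects (Strengthen S-W1 / Decomposition D-W2): the cyclic force is odd, the involution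
  `σ : U ↦ −U(−·)` (coefficients `c_k ↦ −conj c_k`, wind `s ↦ −s`) preserves the windy Galerkin variety and swaps the
  two shores, so (under the regular-value hypothesis of the landed `WindLineReachesCalm`) the wind-line carries
  EXACTLY ONE `σ`-fixed (odd, hence calm) state — a canonical crossing.  Typed: `IsOddCoeff`, `windyVariety`,
  `OnWindLine`, `OddCrossingExists` (Sub₀, provable with the 1-manifold classification), `OddCrossingBounded` (R_w),
  `OddCrossingLoud` (L_w), and the sorry-free glue `cyclicWindLineLoud_of_oddSplit`,
  `windyGalerkinSteadyZerothLaw_of_oddSplit` (through the landed edge `windLineFeedsTarget_proof`).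
  NOT filed as a route split: R_w/L_w re-cut crux 11415's registered stubs 2/3 at one canonical state (stronger R,
  weaker L) without a new estimate — recorded as a reshape hint, see the census § Decomposition.

House rules: statements over tree vocabulary only; `sorry` nowhere (the conjecture-grade objects are `def … : Prop`).
-/

noncomputable section

-- D-0017: single-problem summit ⇒ the duplicated namespace segment is by design.
set_option linter.dupNamespace false

open scoped InnerProductSpace
open MeasureTheory Filter UnitAddTorus
open Literature.Analysis.FunctionSpaces Literature.Analysis.FunctionSpaces.Torus
open Literature.Analysis.FluidPDE

namespace Summit.AnomalousDissipation.AnomalousDissipation.Cruxes.WindyGalerkinSteadyZerothLaw.StrategistS1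

open Summit.AnomalousDissipation.AnomalousDissipation.Theses.WindLine (WindyGalerkinSteadyZerothLaw CyclicWindLineLoud)
open Summit.AnomalousDissipation.AnomalousDissipation.Theorems (windLineFeedsTarget_proof)

/-- The flat three-torus (local notation). -/
local notation "𝕋³" => UnitAddTorus (Fin 3)
/-- Velocity values (local notation). -/
local notation "E³" => EuclideanSpace ℝ (Fin 3)
/-- Complex coefficient vectors (local notation). -/
local notation "ℂ³" => EuclideanSpace ℂ (Fin 3)

/-! ## §1 The wind–loudness trade-off (Negation N-W1; typed, provable now) -/

/-- **Wind–loudness trade-off (tested form, any smooth mean-zero force).**  Let `u` be a windy Galerkin steady state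
of the bracket of X at `(ν, N)` (smooth, divergence free, band-limited to the FULL ball, tested equations against
smooth divergence-free tests band-limited to the punctured ball), with wind `c = ∫u`.  If `A` is an admissible test
field with `(c·∇)A = f` pointwise (for a first-shell force and `c·k ≠ 0` on its six modes: `Â(k) = f̂(k)/(2πi c·k)`),
`‖DA‖ ≤ M` pointwise and `‖ΔA‖₂ ≤ K`, then `ν‖∇u‖² ≤ M ∫|u − c|² + ν K ‖u − c‖₂`.
Proof map (for the prover): split the tested equation at `a := A` with `u = c + U`: `∫⟪c,(c·∇)A⟫ = 0` (exact
derivative), `∫⟪c,(U·∇)A⟫ = 0` (`div U = 0`), `∫⟪U,(c·∇)A⟫ = (U, f) = (u, f)` (`∫f = 0`), `(f, A) = ((c·∇)A, A) = 0`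
(antisymmetry); so `(f,u) = −∫⟪U,(U·∇)A⟫ − ν(U, ΔA)`; and `(f,u) = ν‖∇u‖²` is the energy identity (the wind does no
work; tree `Theorems.WindLineReachesCalm.sum_re_inner_galerkinRHS_eq` at coefficient level).  HONEST WEIGHT (census
N-W1): with `A = A_e/s` for wind `c = s·e`, `e = (1,√2,√3)`, this reads `ε ≤ W/|s| + 6.0·ν√W/|s|` (`W = ∫|u−c|²` the wake
energy; `sup‖DA_e‖_op = max_m 1/e_m = 1`, `‖ΔA_e‖₂ = π√(11/3)`) — a refinement of the injection ceiling `ε ≤ ‖f‖₂√W = 1.22√W` only in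
the corner `|s| > 0.82√W`, and
together with the budget `6s² + W ≤ E` it confines loud witnesses to `|s| < √(E/6)`, which the budget does alone:
essentially NO leverage.  Kept typed so that nobody re-derives it expecting more. [folklore] -/
def WindLoudnessTradeoff : Prop :=
  ∀ (ν : ℝ) (N : ℕ) (f u A : 𝕋³ → E³) (M K : ℝ), 0 ≤ ν → 0 ≤ M → 0 ≤ K →
    IsSmooth f → HasZeroMean f → IsSmooth u → IsDivFree u →
    (∀ k ∉ freqBall N, mFourierCoeff (EuclideanSpace.complexify ∘ u) k = 0) →
    (∀ a : 𝕋³ → E³, IsSmooth a → IsDivFree a →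
      (∀ k ∉ (freqBall N).erase (0 : Fin 3 → ℤ), mFourierCoeff (EuclideanSpace.complexify ∘ a) k = 0) →
      ∫ x, (⟪u x, convect u a x⟫_ℝ + ν * ⟪u x, laplacian a x⟫_ℝ + ⟪f x, a x⟫_ℝ) = 0) →
    IsSmooth A → IsDivFree A →
    (∀ k ∉ (freqBall N).erase (0 : Fin 3 → ℤ), mFourierCoeff (EuclideanSpace.complexify ∘ A) k = 0) →
    (∀ x, Torus.fderiv A x (∫ y, u y) = f x) →
    (∀ x, ‖Torus.fderiv A x‖ ≤ M) → Real.sqrt (∫ x, ‖laplacian A x‖ ^ 2) ≤ K →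
    ν * gradNormSq u ≤ M * (∫ x, ‖u x - ∫ y, u y‖ ^ 2) + ν * K * Real.sqrt (∫ x, ‖u x - ∫ y, u y‖ ^ 2)

/-! ## §2 The odd-crossing objects (Strengthen S-W1 / Decomposition D-W2) -/

/-- **Odd (`σ`-fixed) coefficient vectors**: purely imaginary coefficients.  For a REAL coefficient vector
(`c(−k) = conj c(k)`, part of `galerkinSubspace`) this is exactly oddness of the synthesised field, `U(−x) = −U(x)`;
at `k = 0` it forces the wind `s·(1,√2,√3)` to vanish, so odd states are calm.  The cyclic force
`(sin 2πx₃, sin 2πx₁, sin 2πx₂)` is odd (`f̂(k) = −(i/2)(k₃,k₁,k₂)`). [folklore] -/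
def IsOddCoeff {S : Finset (Fin 3 → ℤ)} (c : ↥S → ℂ³) : Prop :=
  ∀ (k : ↥S) (i : Fin 3), (c k i).re = 0

/-- **The windy Galerkin variety of the cyclic force at `(S, ν)`** — VERBATIM the set-builder of
`WindLine.CyclicWindLineLoud` (real solenoidal coefficient vectors on `S` with mean mode on the line `ℝ·(1,√2,√3)`,
zeros of the tree's `galerkinRHS` driven by the Fourier coefficients of the cyclic force). [folklore] -/
def windyVariety (S : Finset (Fin 3 → ℤ)) (ν : ℝ) : Set (↥S → ℂ³) :=
  {c | c ∈ galerkinSubspace S ∧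
    (∃ s : ℝ, ∀ k : ↥S, (k : Fin 3 → ℤ) = 0 →
      c k = (s : ℂ) • !₂[(1 : ℂ), ((Real.sqrt 2 : ℝ) : ℂ), ((Real.sqrt 3 : ℝ) : ℂ)]) ∧
    galerkinRHS S ν (fun k : ↥S => mFourierCoeff (EuclideanSpace.complexify ∘ fun x : 𝕋³ =>
      !₂[(fourier 1 (x 2) : ℂ).im, (fourier 1 (x 0) : ℂ).im, (fourier 1 (x 1) : ℂ).im]) (k : Fin 3 → ℤ)) c = 0}

/-- **`c` lies on the wind-line of `V`** — VERBATIM the reachability clause of `CyclicWindLineLoud`: the connected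
component of `c` in `V` reaches arbitrarily large wind. [folklore] -/
def OnWindLine {S : Finset (Fin 3 → ℤ)} (V : Set (↥S → ℂ³)) (c : ↥S → ℂ³) : Prop :=
  ∀ Λ : ℝ, ∃ c' ∈ connectedComponentIn V c, ∃ s : ℝ,
    (∀ k : ↥S, (k : Fin 3 → ℤ) = 0 → c' k = (s : ℂ) • !₂[(1 : ℂ), ((Real.sqrt 2 : ℝ) : ℂ), ((Real.sqrt 3 : ℝ) : ℂ)]) ∧
      Λ ≤ s

/-- **Sub₀ — the canonical odd crossing EXISTS (provable; M–L in Lean).**  At fixed `ν > 0` and resolution `N`, if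
`0` is a regular value of the windy Galerkin map on the affine windy space (the hypothesis of the landed
`WindLineReachesCalm`, copied verbatim), every point of the wind-line has an ODD state in its component.  Proof map:
the involution `σ(c)_k = −conj(c_k)` (field `U ↦ −U(−·)`, wind `s ↦ −s`) maps `windyVariety` to itself because the
cyclic force is odd and `galerkinRHS` is `σ`-equivariant; the wind-line `L` reaches `−∞` (landed 11420) and the far
negative shore is `σ`(far positive shore), which lies on `σ(L)`; far-shore uniqueness (landed `stub_farShoreOnWindLine`
/ `eq_of_galerkinRHS_eq_of_wind_ge`) gives `σ(L) ∩ L ≠ ∅`, hence `σ(L) = L`; under the regular-value hypothesis `L` is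
a connected 1-manifold containing a properly embedded ray, hence `≅ ℝ` (Milnor), and `σ|_L` is an end-swapping
homeomorphism of `ℝ`, which has EXACTLY ONE fixed point (IVT + strict monotonicity).  Uniqueness is not claimed in
the signature (existence is what the split consumes). [cite: MilnorTDV1965, Appendix] -/
def OddCrossingExists : Prop :=
  ∀ (ν : ℝ), 0 < ν → ∀ (N : ℕ) (S : Finset (Fin 3 → ℤ)), S = freqBall N →
    ∀ V : Set (↥S → ℂ³), V = windyVariety S ν →
    (∀ c ∈ V, ∀ w ∈ galerkinSubspace S, (∀ k : ↥S, (k : Fin 3 → ℤ) = 0 → w k = 0) →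
      ∃ v ∈ galerkinSubspace S, (∃ t : ℝ, ∀ k : ↥S, (k : Fin 3 → ℤ) = 0 →
        v k = (t : ℂ) • !₂[(1 : ℂ), ((Real.sqrt 2 : ℝ) : ℂ), ((Real.sqrt 3 : ℝ) : ℂ)]) ∧
        fderiv ℝ (fun c : ↥S → ℂ³ => galerkinRHS S ν (fun k : ↥S => mFourierCoeff
          (EuclideanSpace.complexify ∘ fun x : 𝕋³ =>
            !₂[(fourier 1 (x 2) : ℂ).im, (fourier 1 (x 0) : ℂ).im, (fourier 1 (x 1) : ℂ).im]) (k : Fin 3 → ℤ)) c)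
          c v = w) →
    ∀ c ∈ V, OnWindLine V c → ∃ c' ∈ connectedComponentIn V c, IsOddCoeff c'

/-- **R_w — the canonical odd crossing is BOUNDED along `ν_j → 0⁺`, frequently in `N` (bet; energy/continuation
half).**  Some `ν_j → 0⁺` and `E` such that for every `j` and infinitely many `N` the wind-line of the cyclic force at
`(ν_j, freqBall N)` carries an ODD state of energy `Σ‖c_k‖² ≤ E`.  Stronger than crux 11415's stub 2 (which may use
ANY calm crossing); kit j001712 reports one self-symmetric middle crossing per run with `⟨|U|²⟩ ≈ 16–60`
(growing slowly as `ν` falls: the bet).  Probe-independent of X (no loudness). [folklore] -/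
def OddCrossingBounded : Prop :=
  ∃ (ν : ℕ → ℝ) (E : ℝ), (∀ j, 0 < ν j) ∧ Tendsto ν atTop (nhds 0) ∧
    ∀ j, ∃ᶠ N in atTop, ∃ c ∈ windyVariety (freqBall N) (ν j),
      IsOddCoeff c ∧ OnWindLine (windyVariety (freqBall N) (ν j)) c ∧ ∑ k, ‖c k‖ ^ 2 ≤ E

/-- **L_w — bounded odd wind-line states are LOUD, uniformly in small `ν` and large `N` (bet; the zeroth-law half).**
For every energy budget `E` there are `ε, ν₀ > 0` such that for `0 < ν < ν₀` and all large `N`, every ODD state on the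
wind-line of the cyclic force at `(ν, freqBall N)` with `Σ‖c_k‖² ≤ E` dissipates `ν·4π²Σ|k|²‖c_k‖² ≥ ε`.  Weaker than
crux 11415's stub 3 (power floor on ALL bounded wind-reachable calm states): only the canonical crossing is charged.
Vacuous where R_w fails; probe-independent of X (no existence).  This piece carries the whole zeroth-law content of
the crux (census § Decomposition: why the split is not filed). [folklore] -/
def OddCrossingLoud : Prop :=
  ∀ E : ℝ, ∃ ε ν₀ : ℝ, 0 < ε ∧ 0 < ν₀ ∧ ∀ ν : ℝ, 0 < ν → ν < ν₀ → ∀ᶠ N in atTop,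
    ∀ c ∈ windyVariety (freqBall N) ν, IsOddCoeff c → OnWindLine (windyVariety (freqBall N) ν) c →
      ∑ k, ‖c k‖ ^ 2 ≤ E →
      ε ≤ ν * (4 * Real.pi ^ 2 * ∑ k : ↥(freqBall N), freqNormSq (k : Fin 3 → ℤ) * ‖c k‖ ^ 2)

/-- **Glue of the odd split, first leg (sorry-free): `R_w → L_w → CyclicWindLineLoud`.**  Shift the viscosity
sequence past the threshold `ν₀` of `L_w` (`ν'_j := ν_{j+J}`), combine `∃ᶠ N` (R_w) with `∀ᶠ N` (L_w), and read the
matrix of `CyclicWindLineLoud` off the odd bounded wind-line state. [folklore] -/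
theorem cyclicWindLineLoud_of_oddSplit (hR : OddCrossingBounded) (hL : OddCrossingLoud) : CyclicWindLineLoud := by
  obtain ⟨ν, E, hν, hν0, hRj⟩ := hR
  obtain ⟨ε, ν₀, hε, hν₀, hLν⟩ := hL E
  -- eventually `ν j < ν₀`; shift the sequence past that index
  obtain ⟨J, hJ⟩ := Filter.eventually_atTop.1 (hν0.eventually (gt_mem_nhds hν₀))
  refine ⟨fun j => ν (j + J), E, ε, fun j => hν _, ?_, hε, fun j => ?_⟩
  · exact hν0.comp (tendsto_add_atTop_nat J)
  · have h1 := hRj (j + J)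
    have h2 := hLν (ν (j + J)) (hν _) (hJ _ (Nat.le_add_left J j))
    refine (h1.and_eventually h2).mono fun N hN => ?_
    obtain ⟨⟨c, hcV, hodd, hwl, hE⟩, hloud⟩ := hN
    intro S hS V hV
    subst hS
    subst hV
    exact ⟨c, hcV, hwl, hE, hloud c hcV hodd hwl hE⟩

/-- **Glue of the odd split, second leg (sorry-free): `R_w → L_w → X`**, through the route's landed edge
`WindLineFeedsTarget` (`windLineFeedsTarget_proof : CyclicWindLineLoud → WindyGalerkinSteadyZerothLaw`). [folklore] -/
theorem windyGalerkinSteadyZerothLaw_of_oddSplit (hR : OddCrossingBounded) (hL : OddCrossingLoud) :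
    WindyGalerkinSteadyZerothLaw :=
  windLineFeedsTarget_proof (cyclicWindLineLoud_of_oddSplit hR hL)

end Summit.AnomalousDissipation.AnomalousDissipation.Cruxes.WindyGalerkinSteadyZerothLaw.StrategistS1

end
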